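import Mathlib
import Literature.MeasureTheory.Integral.LaplaceTransformUnique

/-!
# Determinacy of the Hausdorff moment problem on `[0,1]` (stub `js_momentDeterminacy`)

Used by line `Sketch` (canonical-lift spine, seat c1) of the crux `CriticalTwoPointGSM`
(stmt-CriticalPhenomena-8365), through `js_noAtom` (no spectral mass at `λ = 0`: the `λ`-marginal of
the joint spectral measure is identified with the axis Hausdorff measure): two finite measures on `ℝ`
carried by `[0,1]` with the same moments `∫ tⁿ dμ` (`n ∈ ℕ`) are equal.

This is known mathematics already in the tree as
`Literature.MeasureTheory.Integral.measure_eq_of_moments_eq_of_Icc` (equal moments ⇒ equal integrals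
of polynomials ⇒ by Weierstrass density of polynomials in `C([0,1])` equal integrals of all bounded
continuous functions ⇒ equal measures, `MeasureTheory.ext_of_forall_integral_eq_of_IsFiniteMeasure`);
here it is only restated in the unbundled-hypotheses form registered by the line's skeleton.
Nothing else is in this file.
-/

noncomputable section

open MeasureTheory Filter Topology
open scoped BigOperators

namespace Summit.CriticalPhenomena.Ising3DConformalLimit.Theorems

/-- **The Hausdorff moment problem on `[0,1]` is determinate (stub `js_momentDeterminacy`).** Two finite
measures on `ℝ` carried by `[0,1]` (i.e. giving no mass to `[0,1]ᶜ`) with the same moments `∫ tⁿ`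
for every `n ∈ ℕ` are equal. Proof: Weierstrass density of polynomials in `C([0,1])` and the fact
that a finite Borel measure on a metric space is determined by the integrals of bounded continuous
functions — packaged in the tree as `Literature.MeasureTheory.Integral.measure_eq_of_moments_eq_of_Icc`
(Feller, *An Introduction to Probability Theory and its Applications* II, VII.3; folklore). -/
theorem js_momentDeterminacy : ∀ μ₁ μ₂ : Measure ℝ, IsFiniteMeasure μ₁ → IsFiniteMeasure μ₂ →
    μ₁ (Set.Icc (0 : ℝ) 1)ᶜ = 0 → μ₂ (Set.Icc (0 : ℝ) 1)ᶜ = 0 →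
    (∀ n : ℕ, ∫ t, t ^ n ∂μ₁ = ∫ t, t ^ n ∂μ₂) → μ₁ = μ₂ := by
  intro μ₁ μ₂ _ _ h₁ h₂ hmom
  exact Literature.MeasureTheory.Integral.measure_eq_of_moments_eq_of_Icc h₁ h₂ hmom

end Summit.CriticalPhenomena.Ising3DConformalLimit.Theorems

end
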